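import Mathlib.RingTheory.KrullDimension.NonZeroDivisors
import Literature.NumberTheory.Transcendental.ExpDominantSolvabilityProofs
import Literature.NumberTheory.Transcendental.ExpVarietiesProofs
import Summits.Schanuel.Schanuel.Theorems.ZilberDefs
import HarnessLib

/-!
# The top rung of the EAC ladder: `d = n` (Brownawell–Masser 2017), certified

`EacOfProjDim n n` (`ZilberDefs.lean`) holds for every `n`: a variety `V = W ∩ (ℂⁿ × (ℂˣ)ⁿ)`
whose additive projection has full Zariski dimension `n` has dominant additive projection
(`vanishingIdeal_eq_bot_of_zariskiDim_eq`: a non-zero `r ∈ I(π₁V)` would force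
`dim ℂ[x]/I(π₁V) + 1 ≤ dim ℂ[x]/(r) + 1 ≤ dim ℂ[x] = n`), so the tree's proved theorem
`Literature.NumberTheory.Transcendental.BrownawellMasser2017_dominantProjection_holds`
(Brownawell–Masser, JLMS 95 (2017), Prop. 2) applies (`eacOfProjDim_self`). Together with
`eacOfProjDim_one` (`ZilberEacRungOne.lean`, Marker's rung `n = 1`) these are the rungs of the
ladder the tree certifies outright; `d = 1` (Mantova–Masser 2024) and `L × W` (Gallinaro 2023)
remain cited facts, `EacRung32` is open.
-/

noncomputable section

open MvPolynomial
open Literature.NumberTheory.Transcendental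

set_option linter.dupNamespace false

namespace Summit.Schanuel.Schanuel.Theorems

/-- A subset of `ℂⁿ` of Zariski dimension `n` is Zariski dense: its vanishing ideal is `⊥`
(a non-zero `r ∈ I(S)` would give `dim ℂ[x]/I(S) ≤ dim ℂ[x]/(r) ≤ n - 1`). [folklore] -/
theorem vanishingIdeal_eq_bot_of_zariskiDim_eq {n : ℕ} {S : Set (Fin n → ℂ)}
    (h : zariskiDim ℂ S = n) : vanishingIdeal ℂ S = ⊥ := by
  by_contra hne
  obtain ⟨r, hrI, hr0⟩ := Submodule.exists_mem_ne_zero_of_ne_bot hne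
  have hR : ringKrullDim (MvPolynomial (Fin n) ℂ) = n := by
    rw [MvPolynomial.ringKrullDim_of_isNoetherianRing, ringKrullDim_eq_zero_of_field, zero_add,
      Nat.card_eq_fintype_card, Fintype.card_fin]
  have h1 : ringKrullDim (MvPolynomial (Fin n) ℂ ⧸ Ideal.span {r}) + 1 ≤ n := by
    rw [← hR]
    exact ringKrullDim_quotient_succ_le_of_nonZeroDivisor (mem_nonZeroDivisors_of_ne_zero hr0)
  have h2 : zariskiDim ℂ S ≤ ringKrullDim (MvPolynomial (Fin n) ℂ ⧸ Ideal.span {r}) := by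
    unfold zariskiDim
    refine ringKrullDim_le_of_surjective (Ideal.Quotient.factor ?_) (Ideal.Quotient.factor_surjective _)
    exact (Ideal.span_singleton_le_iff_mem _).mpr hrI
  rw [h] at h2
  have h3 : (n : WithBot ℕ∞) + 1 ≤ n := le_trans (add_le_add_left h2 1) h1
  have h4 : ((n + 1 : ℕ) : WithBot ℕ∞) ≤ ((n : ℕ) : WithBot ℕ∞) := by exact_mod_cast h3
  have h5 : n + 1 ≤ n := by exact_mod_cast h4
  omega

/-- **The top rung `d = n` is Brownawell–Masser**: `EacOfProjDim n n` holds for every `n`, from the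
tree's `BrownawellMasser2017_dominantProjection_holds` — an additive projection of full Zariski
dimension `n` is dominant (`vanishingIdeal_eq_bot_of_zariskiDim_eq`). Rotundity and freeness are
not needed. [cite: BrownawellMasser2017, Prop. 2 (p. 448)] -/
theorem eacOfProjDim_self (n : ℕ) : EacOfProjDim n n := by
  intro W hW hne _ _ _ hdim hproj
  refine BrownawellMasser2017_dominantProjection_holds n W hW hdim fun p hp => ?_
  have hmem : p ∈ vanishingIdeal ℂ (projAdd '' (W ∩ torusLocus ℂ n)) := by
    rw [mem_vanishingIdeal_iff]
    rintro _ ⟨z, hz, rfl⟩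
    exact hp z hz
  rw [vanishingIdeal_eq_bot_of_zariskiDim_eq hproj] at hmem
  exact hmem

end Summit.Schanuel.Schanuel.Theorems
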